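import Literature.Computability.Complexity.Circuit
import Mathlib.Data.Nat.Log
import Mathlib.Order.ConditionallyCompleteLattice.Basic
import HarnessLib

/-!
# Negation-limited circuits: Markov's and Fischer's theorems

Named facts (D-0014) requested by route PneNP/NegLimited (`wi-03882`), stated over
`Literature.CplxCore.Circuit (Fin n)`, the fan-in-2 De Morgan basis `deMorganBasis = {∧₂, ∨₂, ¬}` and
`Circuit.sizeWith` with the weight `negWeight` counting `GateFn.not` gates.

* `Circuit.negationCount C = C.sizeWith negWeight`, the number of NOT gates of `C`
  (`negationCount_le_size`, `negationCount_eq_zero_of_isOver_monotoneBasis`), and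
  `negLimitedSizeOver B b f`, the least size of a circuit over `B` with `≤ b` NOT gates computing
  `f` (junk `0`; definition request `wi-03885`).
* `jumpsDown f l`, `decrease f` — Markov's *decrease* `d(f)`: the maximum, over increasing chains
  `y¹ < y² < ⋯` in the Boolean cube, of the number of jump-down positions
  (`f yⁱ = 1`, `f yⁱ⁺¹ = 0`). PROVED: `length_le_of_isChain` (a strict chain in `{0,1}ⁿ`
  has at most `n + 1` elements), `jumpsDown_le`, `decrease_le : decrease f ≤ n`, hence
  `clog_decrease_le : ⌈log₂ (d(f)+1)⌉ ≤ ⌈log₂ (n+1)⌉`.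
* Facts: `markov_upper` / `markov_lower` (Markov 1957/58: the inversion complexity of `f` is
  exactly `⌈log₂ (d(f)+1)⌉`; Jukna 2012, §10.2, Theorem "Markov 1957"), `fischer_negationLimited`
  (Fischer 1974/75: size `t` ⇒ size `≤ 2t + O(n² log² n)` with `≤ ⌈log₂ (n+1)⌉` NOT gates;
  Jukna 2012, §10.4, Theorem "Fischer 1974"). `markov_upper` is stated for non-constant `f`
  (the tree's De Morgan basis has no constant gates; see its docstring). PROVED corollary
  `markov_upper.exists_negationCount_le_clog` (`⌈log₂ (n+1)⌉` NOT gates suffice, `f`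
  non-constant).

On constants. Fischer's additive term is `O(n² log² n)`; the fact quantifies `∃ c, … ≤
2 t + c * (n ^ 2 * (Nat.log 2 n) ^ 2 + 1)`, which for `n ≥ 2` is the printed bound and for
`n ≤ 1` is implied by it together with Markov's theorem (finitely many functions), so the fact is
not stronger than the source. Jukna's circuits over `{∧, ∨, ¬}` have fan-in-2 `∧`, `∨` and size
= number of all gates (§1.2), matching `deMorganBasis` and `Circuit.size`.

## References

* A. A. Markov, *On the inversion complexity of a system of functions*, J. ACM 5 (1958) 331–334
  [Markov1958].
* M. J. Fischer, *The complexity of negation-limited networks — a brief survey*, LNCS 33 (1975)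
  71–82 [Fischer1975].
* R. Beals, T. Nishino, K. Tanaka, *On the complexity of negation-limited Boolean networks*,
  SIAM J. Comput. 27 (1998) 1334–1347 [BealsNishinoTanaka1998] (inverter of size `O(n log n)`).
* S. Jukna, *Boolean Function Complexity* (2012), Ch. 10, §§10.2, 10.4 [Jukna2012].
-/

namespace Literature.Computability.Complexity

open Finset

variable {n : ℕ}

/-! ### Counting NOT gates -/

open Classical in
/-- The weight `1` on the NOT gate and `0` on every other gate function. [Jukna 2012, §10.2]
[folklore] -/
noncomputable def negWeight (g : GateFn) : ℕ := if g = GateFn.not then 1 else 0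

/-- `negWeight ¬ = 1`. [folklore] -/
@[simp] theorem negWeight_not : negWeight GateFn.not = 1 := by simp [negWeight]

/-- `negWeight (∧ₖ) = 0`. [folklore] -/
@[simp] theorem negWeight_and (k : ℕ) : negWeight (GateFn.and k) = 0 := by
  simp only [negWeight, ite_eq_right_iff, one_ne_zero, imp_false]
  intro h
  have := congrArg Sigma.fst h
  simp only [GateFn.and, GateFn.not] at this
  subst this
  have h2 := congrFun (eq_of_heq (Sigma.mk.inj h).2) fun _ => true
  simp at h2

/-- `negWeight (∨ₖ) = 0`. [folklore] -/
@[simp] theorem negWeight_or (k : ℕ) : negWeight (GateFn.or k) = 0 := by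
  simp only [negWeight, ite_eq_right_iff, one_ne_zero, imp_false]
  intro h
  have := congrArg Sigma.fst h
  simp only [GateFn.or, GateFn.not] at this
  subst this
  have h2 := congrFun (eq_of_heq (Sigma.mk.inj h).2) fun _ => true
  simp at h2

/-- The number of NOT gates of a circuit: `sizeWith negWeight`. [Jukna 2012, §10.2 (inversion
complexity)] [folklore] -/
noncomputable def Circuit.negationCount {ι : Type*} (C : Circuit ι) : ℕ := C.sizeWith negWeight

/-- Unfolding `negationCount`. [folklore] -/
theorem Circuit.negationCount_eq {ι : Type*} (C : Circuit ι) :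
    C.negationCount = C.sizeWith negWeight := rfl

/-- `negWeight g ≤ 1`. [folklore] -/
theorem negWeight_le_one (g : GateFn) : negWeight g ≤ 1 := by
  unfold negWeight; split <;> simp

/-- A circuit has at most `size` NOT gates. [folklore] -/
theorem Circuit.negationCount_le_size {ι : Type*} (C : Circuit ι) : C.negationCount ≤ C.size := by
  rw [Circuit.negationCount_eq, Circuit.sizeWith, Circuit.size]
  suffices ∀ l : List (Gate ι), (l.map fun g => negWeight g.fn).sum ≤ l.length from this _
  intro l
  induction l with
  | nil => simp
  | cons g l ih =>
    have := negWeight_le_one g.fn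
    simp only [List.map_cons, List.sum_cons, List.length_cons]
    omega

/-- A circuit over the monotone basis `{∧₂, ∨₂}` has no NOT gates. [Jukna 2012, §10.1]
[folklore] -/
theorem Circuit.negationCount_eq_zero_of_isOver_monotoneBasis {ι : Type*} {C : Circuit ι}
    (hC : C.IsOver monotoneBasis) : C.negationCount = 0 := by
  rw [Circuit.negationCount_eq, Circuit.sizeWith]
  refine List.sum_eq_zero fun w hw => ?_
  obtain ⟨g, hg, rfl⟩ := List.mem_map.1 hw
  have hg' := hC g hg
  simp only [monotoneBasis, Set.mem_insert_iff, Set.mem_singleton_iff] at hg'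
  rcases hg' with h | h <;> simp [h]

/-- The **negation-limited circuit complexity** of `f` over the basis `B` with NOT-budget `b`:
the least size of a circuit over `B` with at most `b` NOT gates computing `f`. **Junk value `0`**
if there is no such circuit (cf. `circuitSizeOver`). [Jukna 2012, §10.5 (classes `P(r)`)]
[cite: Jukna2012, §10.5] -/
noncomputable def negLimitedSizeOver {ι : Type*} (B : Set GateFn) (b : ℕ)
    (f : (ι → Bool) → Bool) : ℕ :=
  sInf {s | ∃ C : Circuit ι, C.IsOver B ∧ C.negationCount ≤ b ∧ C.Computes f ∧ C.size = s}

/-- Any circuit over `B` with `≤ b` negations computing `f` bounds `negLimitedSizeOver B b f`.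
[folklore] -/
theorem negLimitedSizeOver_le_of_computes {ι : Type*} {B : Set GateFn} {b : ℕ}
    {f : (ι → Bool) → Bool} (C : Circuit ι) (hB : C.IsOver B) (hb : C.negationCount ≤ b)
    (hf : C.Computes f) : negLimitedSizeOver B b f ≤ C.size :=
  Nat.sInf_le ⟨C, hB, hb, hf, rfl⟩

/-- With budget `0` over the De Morgan basis any monotone-basis circuit is admissible, so
`negLimitedSizeOver deMorganBasis 0 f ≤ C.size` for `C` over `{∧₂, ∨₂}`. [folklore] -/
theorem negLimitedSizeOver_zero_le_of_monotone {ι : Type*} {f : (ι → Bool) → Bool}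
    (C : Circuit ι) (hB : C.IsOver monotoneBasis) (hf : C.Computes f) :
    negLimitedSizeOver deMorganBasis 0 f ≤ C.size :=
  negLimitedSizeOver_le_of_computes C (hB.mono monotoneBasis_subset_deMorgan)
    (Circuit.negationCount_eq_zero_of_isOver_monotoneBasis hB).le hf

/-! ### Markov's decrease `d(f)` -/

/-- The number of *jump-down positions* of `f` along a list `y¹, y², …`: indices `i` with
`f yⁱ = true` and `f yⁱ⁺¹ = false`. [Jukna 2012, §10.2] [folklore] -/
def jumpsDown (f : (Fin n → Bool) → Bool) : List (Fin n → Bool) → ℕ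
  | a :: b :: l => (if f a = true ∧ f b = false then 1 else 0) + jumpsDown f (b :: l)
  | _ => 0

/-- `jumpsDown` of a list is less than its length (at most `length - 1` consecutive pairs).
[folklore] -/
theorem jumpsDown_lt_length (f : (Fin n → Bool) → Bool) :
    ∀ (a : Fin n → Bool) (l : List (Fin n → Bool)), jumpsDown f (a :: l) < (a :: l).length
  | a, [] => by simp [jumpsDown]
  | a, b :: l => by
    have := jumpsDown_lt_length f b l
    simp only [jumpsDown, List.length_cons] at this ⊢
    split <;> omega

/-- The **decrease** `d(f)` of a Boolean function: the maximum number of jump-down positions of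
`f` along a strictly increasing chain in the Boolean cube `{0,1}ⁿ` (coordinatewise order).
[Jukna 2012, §10.2] [cite: Jukna2012, §10.2] -/
noncomputable def decrease (f : (Fin n → Bool) → Bool) : ℕ :=
  sSup {d | ∃ l : List (Fin n → Bool), l.IsChain (· < ·) ∧ jumpsDown f l = d}

/-- Along a strict inequality `a < b` in the cube the number of ones strictly increases.
[folklore] -/
theorem numOnes_lt_of_lt {a b : Fin n → Bool} (h : a < b) : GateFn.numOnes a < GateFn.numOnes b := by
  obtain ⟨hle, hne⟩ := lt_iff_le_and_ne.1 h
  unfold GateFn.numOnes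
  apply Finset.card_lt_card
  refine Finset.ssubset_iff_subset_ne.2 ⟨fun i hi => ?_, fun heq => hne ?_⟩
  · simp only [Finset.mem_filter, Finset.mem_univ, true_and] at hi ⊢
    have := hle i
    rw [hi] at this
    exact top_le_iff.1 this
  · funext i
    have hi := congrArg (i ∈ ·) heq
    simp only [Finset.mem_filter, Finset.mem_univ, true_and, eq_iff_iff] at hi
    rcases ha : a i <;> rcases hb : b i <;> simp_all

/-- A strictly increasing chain in `{0,1}ⁿ` has at most `n + 1` elements. [Jukna 2012, §10.2]
[folklore] -/
theorem length_le_of_isChain {l : List (Fin n → Bool)} (hl : l.IsChain (· < ·)) :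
    l.length ≤ n + 1 := by
  have hmap : (l.map GateFn.numOnes).IsChain (· < ·) :=
    List.isChain_map_of_isChain _ (fun _ _ h => numOnes_lt_of_lt h) hl
  have hp : (l.map GateFn.numOnes).Pairwise (· < ·) := List.isChain_iff_pairwise.1 hmap
  have hnd : (l.map GateFn.numOnes).Nodup := hp.imp ne_of_lt
  have hsub : l.map GateFn.numOnes ⊆ List.range (n + 1) := by
    intro k hk
    obtain ⟨a, -, rfl⟩ := List.mem_map.1 hk
    simp only [List.mem_range, Nat.lt_succ_iff, GateFn.numOnes]
    exact (Finset.card_filter_le _ _).trans (by simp)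
  have := (hnd.subperm hsub).length_le
  simpa using this

/-- Along a strict chain, `f` jumps down at most `n` times. [Jukna 2012, §10.2 (`d(f) ≤ n/2`, weak
form)] [folklore] -/
theorem jumpsDown_le (f : (Fin n → Bool) → Bool) {l : List (Fin n → Bool)}
    (hl : l.IsChain (· < ·)) : jumpsDown f l ≤ n := by
  cases l with
  | nil => simp [jumpsDown]
  | cons a l =>
    have h1 := jumpsDown_lt_length f a l
    have h2 := length_le_of_isChain hl
    omega

/-- The set defining `decrease f` is bounded above by `n`. [folklore] -/
theorem bddAbove_decrease (f : (Fin n → Bool) → Bool) :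
    BddAbove {d | ∃ l : List (Fin n → Bool), l.IsChain (· < ·) ∧ jumpsDown f l = d} :=
  ⟨n, by rintro _ ⟨l, hl, rfl⟩; exact jumpsDown_le f hl⟩

/-- Every strict chain witnesses a lower bound for the decrease. [folklore] -/
theorem jumpsDown_le_decrease (f : (Fin n → Bool) → Bool) {l : List (Fin n → Bool)}
    (hl : l.IsChain (· < ·)) : jumpsDown f l ≤ decrease f :=
  le_csSup (bddAbove_decrease f) ⟨l, hl, rfl⟩

/-- **`d(f) ≤ n`.** [Jukna 2012, §10.2] [folklore] -/
theorem decrease_le (f : (Fin n → Bool) → Bool) : decrease f ≤ n :=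
  csSup_le ⟨0, [], List.IsChain.nil, rfl⟩ (by rintro _ ⟨l, hl, rfl⟩; exact jumpsDown_le f hl)

/-- Hence Markov's bound `⌈log₂ (d(f)+1)⌉` is at most `⌈log₂ (n+1)⌉`. [Jukna 2012, §10.4, first
paragraph] [folklore] -/
theorem clog_decrease_le (f : (Fin n → Bool) → Bool) :
    Nat.clog 2 (decrease f + 1) ≤ Nat.clog 2 (n + 1) :=
  Nat.clog_mono_right 2 (Nat.succ_le_succ (decrease_le f))

/-- A monotone function has decrease `0`. [Jukna 2012, §10.2] [folklore] -/
theorem decrease_eq_zero_of_monotone {f : (Fin n → Bool) → Bool} (hf : Monotone f) :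
    decrease f = 0 := by
  refine le_antisymm (csSup_le ⟨0, [], List.IsChain.nil, rfl⟩ ?_) (Nat.zero_le _)
  rintro _ ⟨l, hl, rfl⟩
  suffices ∀ l : List (Fin n → Bool), l.IsChain (· < ·) → jumpsDown f l = 0 from (this l hl).le
  intro l hl
  induction l with
  | nil => rfl
  | cons a l ih =>
    cases l with
    | nil => rfl
    | cons b l =>
      have hab : a < b := List.IsChain.rel hl
      have htl := ih hl.tail
      simp only [jumpsDown, htl, add_zero, ite_eq_right_iff, one_ne_zero, imp_false, not_and]
      intro ha hb
      have := hf hab.le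
      rw [ha, hb] at this
      exact absurd this (by decide)

/-! ### Named facts -/

/-- **Markov's theorem, upper bound** (Markov 1957/58; Jukna 2012, §10.2, Theorem (Markov 1957)
with Lemma "Lower bound" `d(f) ≥ 2^{I(f)} - 1`, i.e. `I(f) ≤ ⌈log₂ (d(f)+1)⌉`): every
NON-CONSTANT Boolean function `f` of `n` variables is computed by a fan-in-2 circuit over
`{∧, ∨, ¬}` with at most `⌈log₂ (d(f)+1)⌉` NOT gates. Restriction to non-constant `f` (review of
p3128): the tree's `deMorganBasis = {∧₂, ∨₂, ¬}` has no constant gates, so a constant `f`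
(`d(f) = 0`) has no NOT-free circuit here, whereas Markov/Jukna allow the constants; for
non-constant `f` constant inputs can be eliminated by propagation without new NOT gates, so this
form is implied by the printed theorem. (For constants use one NOT gate, `x ∧ ¬x` / `x ∨ ¬x`,
within Fischer's budget `⌈log₂ (n+1)⌉ ≥ 1`.) [cite: Jukna2012, §10.2 Thm. (Markov 1957)] -/
def markov_upper : Prop :=
  ∀ ⦃n : ℕ⦄ (f : (Fin n → Bool) → Bool), (∃ x y, f x ≠ f y) →
    ∃ C : Circuit (Fin n), C.IsOver deMorganBasis ∧ C.Computes f ∧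
      C.negationCount ≤ Nat.clog 2 (decrease f + 1)

/-- **Markov's theorem, lower bound** (Markov 1957/58; Jukna 2012, §10.2, Theorem (Markov 1957)
with Lemma "Upper bound" `d(f) ≤ 2^{I(f)} - 1`): every circuit over `{∧, ∨, ¬}` computing `f`
has at least `⌈log₂ (d(f)+1)⌉` NOT gates. [cite: Jukna2012, §10.2 Thm. (Markov 1957)] -/
def markov_lower : Prop :=
  ∀ ⦃n : ℕ⦄ (f : (Fin n → Bool) → Bool) (C : Circuit (Fin n)),
    C.IsOver deMorganBasis → C.Computes f → Nat.clog 2 (decrease f + 1) ≤ C.negationCount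

/-- **Fischer's theorem** (Fischer 1974/75; Jukna 2012, §10.4, Theorem (Fischer 1974)): if a
function of `n` variables is computed by a circuit over `{∧, ∨, ¬}` of size `t`, then it is
computed by a circuit of size at most `2t + O(n² log² n)` using at most `⌈log₂ (n+1)⌉` NOT gates.
The `O`-constant is existentially quantified, uniformly in `n`, `f`, `t` (see the module
docstring for `n ≤ 1`). [cite: Jukna2012, §10.4 Thm. (Fischer 1974)] -/
def fischer_negationLimited : Prop :=
  ∃ c : ℕ, ∀ ⦃n : ℕ⦄ (f : (Fin n → Bool) → Bool) (C : Circuit (Fin n)),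
    C.IsOver deMorganBasis → C.Computes f →
      ∃ C' : Circuit (Fin n), C'.IsOver deMorganBasis ∧ C'.Computes f ∧
        C'.negationCount ≤ Nat.clog 2 (n + 1) ∧
        C'.size ≤ 2 * C.size + c * (n ^ 2 * (Nat.log 2 n) ^ 2 + 1)

/-- Corollary of Markov's upper bound and `decrease_le`: `⌈log₂ (n+1)⌉` NOT gates suffice for
every non-constant `f` (no size control; for polynomial overhead, and for constants, use
`fischer_negationLimited`). [Jukna 2012, §10.4, first paragraph] [folklore] -/
theorem markov_upper.exists_negationCount_le_clog (h : markov_upper)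
    (f : (Fin n → Bool) → Bool) (hf : ∃ x y, f x ≠ f y) :
    ∃ C : Circuit (Fin n), C.IsOver deMorganBasis ∧ C.Computes f ∧
      C.negationCount ≤ Nat.clog 2 (n + 1) := by
  obtain ⟨C, hB, hC, hneg⟩ := h f hf
  exact ⟨C, hB, hC, hneg.trans (clog_decrease_le f)⟩

/-- Corollary of Fischer's theorem in "polynomial overhead" form: there is a fixed polynomial
bound `p (n, t) = 2 t + c (n² log² n + 1)` such that size-`t` circuits become size-`≤ p` circuits
with `≤ ⌈log₂ (n+1)⌉` negations; in particular `p (n, t) ≤ 2 t + c (n ^ 4 + 1)`. [folklore] -/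
theorem fischer_negationLimited.exists_le_pow (h : fischer_negationLimited) :
    ∃ c : ℕ, ∀ ⦃n : ℕ⦄ (f : (Fin n → Bool) → Bool) (C : Circuit (Fin n)),
      C.IsOver deMorganBasis → C.Computes f →
        ∃ C' : Circuit (Fin n), C'.IsOver deMorganBasis ∧ C'.Computes f ∧
          C'.negationCount ≤ Nat.clog 2 (n + 1) ∧ C'.size ≤ 2 * C.size + c * (n ^ 4 + 1) := by
  obtain ⟨c, hc⟩ := h
  refine ⟨c, fun n f C hB hf => ?_⟩
  obtain ⟨C', hB', hf', hneg, hsize⟩ := hc f C hB hf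
  refine ⟨C', hB', hf', hneg, hsize.trans ?_⟩
  have hlog : Nat.log 2 n ≤ n := Nat.log_le_self 2 n
  have : n ^ 2 * Nat.log 2 n ^ 2 ≤ n ^ 4 := by
    calc n ^ 2 * Nat.log 2 n ^ 2 ≤ n ^ 2 * n ^ 2 :=
          Nat.mul_le_mul_left _ (Nat.pow_le_pow_left hlog 2)
      _ = n ^ 4 := by rw [← pow_add]
  exact Nat.add_le_add_left (Nat.mul_le_mul_left c (Nat.add_le_add_right this 1)) _

end Literature.Computability.Complexity
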